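import Mathlib
import Summits.NavierStokesRegularity.NavierStokesRegularity.Theorems.PoloidalWindowDoorPoloidalWindowRigidityZShockTurningShearIndefinite

/-!
# Crux K2 `PoloidalWindowRigidity` (stmt-NavierStokesRegularity-19708), line `z_shock` — R3 inhabitant census: QUADRATIC SLICES
# WITH AN ARBITRARY STRUCTURE FUNCTION (VII) — a RANK-ONE (parabolic-cylinder) quadratic slice whose linear part is transverse to
# the cylinder axis forces, at ONE height, an affine structure function on all of `ℝ`

`--supports stmt-NavierStokesRegularity-19708 --as helper` (leafhand-ns-poloidalwindowdoor-3 g21, cell decomp-ns, 2026-09-01).  Class-free,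
def-free; Mathlib + parts II–V of the series.  **No stub and no summit is closed by this file; Navier–Stokes regularity is NOT proved
here (rung 0).**

Parts III–VI left the RANK-ONE quadratic part `DG = E²`, `(D,E,G) ≠ 0` as the residue of the quadratic family.  Write (for `D ≠ 0`)
`W(y) = A + By₀ + Cy₁ + (Dy₀ + Ey₁)²/(2D)`; the Hessian has the kernel direction `k = (−E, D)` and `β = CD − BE = ∇W·k` is constant.
This part treats the TRANSVERSE case `β ≠ 0` (the slice is NOT a function of `Dy₀ + Ey₁` alone; such slices are twisted in general):

* ★ `quadSlice_rank1_affine` — if `γ` is differentiable, `D ≠ 0`, `DG = E²`, `CD − BE ≠ 0`, and at ONE height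
  `ℓ(y) = γ(W(y))(D + G) + γ'(W(y))|∇W(y)|²` for all `y` with some quadratic polynomial `ℓ`, then `γ(t) = γ₀ + 2μt`, `γ'(t) = 2μ` for
  all real `t`.  Proof: translating by `τk` shifts `W` by `τβ` and leaves `|∇W|²` unchanged, so along each line `y + ℝk` the identity
  reads `(D+G)γ(t) + P(y)γ'(t) = Φ_y(t)` with `Φ_y` an explicit quadratic polynomial in `t ∈ ℝ`; two base points `y = (j, 0)`,
  `j ∈ {0, 1, −1}`, with different `P` (they exist: `D² + E² > 0`) make `(D+G)γ` and `γ'` polynomials of degree `≤ 2`; uniqueness of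
  the derivative makes `γ'` affine; finally the identity along the axis `y = (y₀, 0)`, read through its fourth finite difference in
  `y₀`, kills the quadratic coefficient of `γ` (`(D+G)D = D² + E²`, coefficient `30·s₂·D(D² + E²)`).
* `quadSlice_rank1_affine_swap` — the case `D = 0` (then `E = 0`, `G ≠ 0`, transversality `B ≠ 0`) by the symmetry `y₀ ↔ y₁`.
* ★ `quadSlice_rank1_TH` — all heights: data of part II at every height + ONE transverse rank-one height ⇒ `γ' ≡ 0` on `ℝ` (part II's
  `quadSlice_flat_of_affine_thick` on the globally affine `γ`; a thick affine law would force `D ≡ G ≡ 0` at that height).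

Residue of the quadratic family after parts I–VII (any differentiable `γ`): patterns on the THICK column whose quadratic part is, at EVERY
height, semi-definite (VI) and either definite or an ALIGNED parabolic cylinder (`β = 0`: the slice is a function of one linear coordinate
at that height), and not definite at every height (IV).  Honest scope: toy sub-family of R3 (`hGN` stays XL, not in print); kinematic
(no NS); ansatz substitution taken as hypothesis.  presearch: as parts III–VI. [folklore]
-/

noncomputable section

namespace Summit.NavierStokesRegularity.NavierStokesRegularity.Theorems.PoloidalWindowDoorPoloidalWindowRigidityZShockTurningShearParabolic

-- the summit and its single sub-problem share the name (CONVENTIONS §1)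
set_option linter.dupNamespace false

open Set Filter Topology
open Summit.NavierStokesRegularity.NavierStokesRegularity.Theorems.PoloidalWindowDoorPoloidalWindowRigidityZShockTurningShearQuadratic

/-! ## Single height: transverse parabolic cylinder -/

/-- ★ **A transverse rank-one quadratic slice at ONE height forces an affine structure function on `ℝ`.**  `γ` differentiable with
derivative `γ'`; `W(y) = A + By₀ + Cy₁ + ½(Dy₀² + 2Ey₀y₁ + Gy₁²)` with `D ≠ 0`, `DG = E²` (rank one) and `CD − BE ≠ 0` (the linear
part is transverse to the axis); `ℓ` any quadratic polynomial with `ℓ = γ(W)(D+G) + γ'(W)|∇W|²` on `ℝ²`.  Then `γ(t) = γ₀ + 2μt` and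
`γ'(t) = 2μ` for all `t`. [folklore] -/
theorem quadSlice_rank1_affine {γ γ' : ℝ → ℝ} (hγ : ∀ t, HasDerivAt γ (γ' t) t)
    {A B C D E G a b c d e g : ℝ} {W P ℓ : ℝ → ℝ → ℝ}
    (hW : ∀ y₀ y₁, W y₀ y₁ = A + B * y₀ + C * y₁ + (D * y₀ ^ 2 + 2 * E * y₀ * y₁ + G * y₁ ^ 2) / 2)
    (hP : ∀ y₀ y₁, P y₀ y₁ = (B + D * y₀ + E * y₁) ^ 2 + (C + E * y₀ + G * y₁) ^ 2)
    (hℓ : ∀ y₀ y₁, ℓ y₀ y₁ = a + b * y₀ + c * y₁ + (d * y₀ ^ 2 + 2 * e * y₀ * y₁ + g * y₁ ^ 2) / 2)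
    (hD : D ≠ 0) (hDG : D * G = E ^ 2) (hβ : C * D - B * E ≠ 0)
    (hpde : ∀ y₀ y₁, ℓ y₀ y₁ = γ (W y₀ y₁) * (D + G) + γ' (W y₀ y₁) * P y₀ y₁) :
    ∃ γ₀ μ : ℝ, (∀ t, γ t = γ₀ + 2 * μ * t) ∧ (∀ t, γ' t = 2 * μ) := by
  set β := C * D - B * E with hβdef
  set T := D + G with hTdef
  have hG : G = E ^ 2 / D := by field_simp; linear_combination hDG
  have hTD : T * D = D ^ 2 + E ^ 2 := by rw [hTdef]; linear_combination hDG
  have hT : T ≠ 0 := by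
    intro h0
    have h1 : D ^ 2 + E ^ 2 = 0 := by rw [← hTD, h0, zero_mul]
    have h2 : D ^ 2 = 0 := by nlinarith [sq_nonneg D, sq_nonneg E]
    exact hD (pow_eq_zero_iff two_ne_zero |>.mp h2)
  -- translation by `τ k`, `k = (−E, D)`: `W` shifts by `τβ`, `P` is invariant, `ℓ` is an explicit quadratic in `τ`
  have hWk : ∀ y₀ y₁ τ, W (y₀ + τ * (-E)) (y₁ + τ * D) = W y₀ y₁ + τ * β := by
    intro y₀ y₁ τ
    rw [hW, hW, hβdef]
    linear_combination (τ ^ 2 * D / 2 + τ * y₁) * hDG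
  have hPk : ∀ y₀ y₁ τ, P (y₀ + τ * (-E)) (y₁ + τ * D) = P y₀ y₁ := by
    intro y₀ y₁ τ
    rw [hP, hP]
    linear_combination (2 * τ * (C + E * y₀ + G * y₁) + τ ^ 2 * G * D - τ ^ 2 * E ^ 2) * hDG
  -- the identity along the line through `(j, 0)`: for every real `t`
  have line : ∀ j t : ℝ, γ t * T + γ' t * P j 0 =
      ℓ (j + ((t - W j 0) / β) * (-E)) (0 + ((t - W j 0) / β) * D) := by
    intro j t
    have h1 := hpde (j + ((t - W j 0) / β) * (-E)) (0 + ((t - W j 0) / β) * D)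
    rw [hWk, hPk] at h1
    have h2 : W j 0 + (t - W j 0) / β * β = t := by field_simp; ring
    rw [h2] at h1
    exact h1.symm
  -- an explicit quadratic polynomial in `t` for each base point `j`
  have quadℓ : ∀ j t : ℝ, ℓ (j + ((t - W j 0) / β) * (-E)) (0 + ((t - W j 0) / β) * D) =
      ℓ (j + ((0 - W j 0) / β) * (-E)) (0 + ((0 - W j 0) / β) * D) +
      ((ℓ (j + ((1 - W j 0) / β) * (-E)) (0 + ((1 - W j 0) / β) * D) -
        ℓ (j + ((-1 - W j 0) / β) * (-E)) (0 + ((-1 - W j 0) / β) * D)) / 2) * t +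
      ((ℓ (j + ((1 - W j 0) / β) * (-E)) (0 + ((1 - W j 0) / β) * D) +
        ℓ (j + ((-1 - W j 0) / β) * (-E)) (0 + ((-1 - W j 0) / β) * D) -
        2 * ℓ (j + ((0 - W j 0) / β) * (-E)) (0 + ((0 - W j 0) / β) * D)) / 2) * t ^ 2 := by
    intro j t
    simp only [hℓ]
    ring
  -- two base points among `j = 0, 1, −1` with different `P`
  obtain ⟨i, j, hPij⟩ : ∃ i j : ℝ, P i 0 ≠ P j 0 := by
    by_cases h01 : P 0 0 = P 1 0
    · refine ⟨0, -1, fun h0m => ?_⟩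
      rw [hP, hP] at h01 h0m
      have h1 : D ^ 2 + E ^ 2 = 0 := by nlinarith [h01, h0m]
      have h2 : D ^ 2 = 0 := by nlinarith [sq_nonneg D, sq_nonneg E]
      exact hD (pow_eq_zero_iff two_ne_zero |>.mp h2)
    · exact ⟨0, 1, h01⟩
  -- abbreviations for the two quadratics
  set Φi : ℝ → ℝ := fun t => ℓ (i + ((t - W i 0) / β) * (-E)) (0 + ((t - W i 0) / β) * D) with hΦi
  set Φj : ℝ → ℝ := fun t => ℓ (j + ((t - W j 0) / β) * (-E)) (0 + ((t - W j 0) / β) * D) with hΦj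
  have hli : ∀ t, γ t * T + γ' t * P i 0 = Φi t := fun t => line i t
  have hlj : ∀ t, γ t * T + γ' t * P j 0 = Φj t := fun t => line j t
  have hqi : ∀ t, Φi t = Φi 0 + ((Φi 1 - Φi (-1)) / 2) * t + ((Φi 1 + Φi (-1) - 2 * Φi 0) / 2) * t ^ 2 :=
    fun t => quadℓ i t
  have hqj : ∀ t, Φj t = Φj 0 + ((Φj 1 - Φj (-1)) / 2) * t + ((Φj 1 + Φj (-1) - 2 * Φj 0) / 2) * t ^ 2 :=
    fun t => quadℓ j t
  -- `γ'` and `Tγ` are quadratic polynomials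
  have hPne : P i 0 - P j 0 ≠ 0 := sub_ne_zero.mpr hPij
  have hγ'q : ∀ t, γ' t = (Φi t - Φj t) / (P i 0 - P j 0) := by
    intro t
    rw [eq_div_iff hPne]
    linear_combination hli t - hlj t
  have hγq : ∀ t, γ t * T = Φi t - P i 0 * ((Φi t - Φj t) / (P i 0 - P j 0)) := by
    intro t; rw [← hγ'q t]; linear_combination hli t
  -- collect: `γ t * T = s₀ + s₁ t + s₂ t²`, `γ' t = (u₀ + u₁ t + u₂ t²)`
  obtain ⟨s₀, s₁, s₂, hs⟩ : ∃ s₀ s₁ s₂ : ℝ, ∀ t, γ t * T = s₀ + s₁ * t + s₂ * t ^ 2 := by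
    refine ⟨Φi 0 - P i 0 * ((Φi 0 - Φj 0) / (P i 0 - P j 0)),
      (Φi 1 - Φi (-1)) / 2 - P i 0 * (((Φi 1 - Φi (-1)) / 2 - (Φj 1 - Φj (-1)) / 2) / (P i 0 - P j 0)),
      (Φi 1 + Φi (-1) - 2 * Φi 0) / 2 -
        P i 0 * (((Φi 1 + Φi (-1) - 2 * Φi 0) / 2 - (Φj 1 + Φj (-1) - 2 * Φj 0) / 2) / (P i 0 - P j 0)), fun t => ?_⟩
    rw [hγq t, hqi t, hqj t]
    field_simp
    ring
  obtain ⟨u₀, u₁, u₂, hu⟩ : ∃ u₀ u₁ u₂ : ℝ, ∀ t, γ' t = u₀ + u₁ * t + u₂ * t ^ 2 := by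
    refine ⟨(Φi 0 - Φj 0) / (P i 0 - P j 0), ((Φi 1 - Φi (-1)) / 2 - (Φj 1 - Φj (-1)) / 2) / (P i 0 - P j 0),
      ((Φi 1 + Φi (-1) - 2 * Φi 0) / 2 - (Φj 1 + Φj (-1) - 2 * Φj 0) / 2) / (P i 0 - P j 0), fun t => ?_⟩
    rw [hγ'q t, hqi t, hqj t]
    field_simp
    ring
  -- uniqueness of the derivative: `γ' t * T = s₁ + 2 s₂ t`
  have hγfun : γ = fun t => (s₀ + s₁ * t + s₂ * t ^ 2) / T := by
    funext t; rw [eq_div_iff hT]; exact hs t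
  have hderiv : ∀ t, γ' t * T = s₁ + 2 * s₂ * t := by
    intro t
    have h1 : HasDerivAt (fun t => (s₀ + s₁ * t + s₂ * t ^ 2) / T) ((s₁ + s₂ * (2 * t)) / T) t := by
      have h2 : HasDerivAt (fun t => s₀ + s₁ * t + s₂ * t ^ 2) (s₁ + s₂ * (2 * t)) t := by
        have h3 := ((hasDerivAt_const_mul s₁ (x := t)).const_add s₀).fun_add
          (((hasDerivAt_id t).fun_mul (hasDerivAt_id t)).const_mul s₂)
        have h4 : (fun t : ℝ => s₀ + s₁ * t + s₂ * t ^ 2) = fun x => s₀ + s₁ * x + s₂ * (id x * id x) := by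
          funext x; simp only [id]; ring
        rw [h4]
        refine h3.congr_deriv ?_
        simp only [id]; ring
      exact h2.div_const T
    have h5 : HasDerivAt γ ((s₁ + s₂ * (2 * t)) / T) t := by rw [hγfun]; exact h1
    have h6 := (hγ t).unique h5
    rw [h6]; field_simp
  -- the identity along the axis `y = (y₀, 0)`, multiplied by `T`
  have axis : ∀ y₀, T * ℓ y₀ 0 = (s₀ + s₁ * W y₀ 0 + s₂ * W y₀ 0 ^ 2) * T + (s₁ + 2 * s₂ * W y₀ 0) * P y₀ 0 := by
    intro y₀
    have h1 := hpde y₀ 0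
    have h2 := hs (W y₀ 0)
    have h3 := hderiv (W y₀ 0)
    calc T * ℓ y₀ 0 = (γ (W y₀ 0) * T) * T + (γ' (W y₀ 0) * T) * P y₀ 0 := by rw [h1]; ring
      _ = _ := by rw [h2, h3]
  -- fourth finite difference in `y₀`: the quartic coefficient `(5/4) s₂ D (D² + E²)` must vanish
  have hs₂ : s₂ = 0 := by
    have h0 := axis 0
    have h1 := axis 1
    have h2 := axis 2
    have h3 := axis 3
    have h4 := axis 4
    simp only [hW, hP, hℓ, hTdef] at h0 h1 h2 h3 h4
    have key : 30 * s₂ * D * (D ^ 2 + E ^ 2) = 0 := by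
      linear_combination (-1 : ℝ) * (h4 - 4 * h3 + 6 * h2 - 4 * h1 + h0) + (-6 * s₂ * D) * hDG
    have hDE : D * (D ^ 2 + E ^ 2) ≠ 0 := by
      have : 0 < D ^ 2 + E ^ 2 := by positivity
      exact mul_ne_zero hD this.ne'
    have : 30 * s₂ * (D * (D ^ 2 + E ^ 2)) = 0 := by linear_combination key
    rcases mul_eq_zero.mp this with h | h
    · linarith
    · exact absurd h hDE
  refine ⟨s₀ / T, s₁ / (2 * T), fun t => ?_, fun t => ?_⟩
  · have h1 := hs t
    rw [hs₂] at h1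
    field_simp
    linear_combination h1
  · have h1 := hderiv t
    rw [hs₂] at h1
    field_simp
    linear_combination h1

/-- **The case `D = 0`** (then `E = 0`, `G ≠ 0` and transversality reads `B ≠ 0`) by the symmetry `y₀ ↔ y₁`. [folklore] -/
theorem quadSlice_rank1_affine_swap {γ γ' : ℝ → ℝ} (hγ : ∀ t, HasDerivAt γ (γ' t) t)
    {A B C D E G a b c d e g : ℝ} {W P ℓ : ℝ → ℝ → ℝ}
    (hW : ∀ y₀ y₁, W y₀ y₁ = A + B * y₀ + C * y₁ + (D * y₀ ^ 2 + 2 * E * y₀ * y₁ + G * y₁ ^ 2) / 2)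
    (hP : ∀ y₀ y₁, P y₀ y₁ = (B + D * y₀ + E * y₁) ^ 2 + (C + E * y₀ + G * y₁) ^ 2)
    (hℓ : ∀ y₀ y₁, ℓ y₀ y₁ = a + b * y₀ + c * y₁ + (d * y₀ ^ 2 + 2 * e * y₀ * y₁ + g * y₁ ^ 2) / 2)
    (hG : G ≠ 0) (hDG : D * G = E ^ 2) (hβ : B * G - C * E ≠ 0)
    (hpde : ∀ y₀ y₁, ℓ y₀ y₁ = γ (W y₀ y₁) * (D + G) + γ' (W y₀ y₁) * P y₀ y₁) :
    ∃ γ₀ μ : ℝ, (∀ t, γ t = γ₀ + 2 * μ * t) ∧ (∀ t, γ' t = 2 * μ) :=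
  quadSlice_rank1_affine hγ (A := A) (B := C) (C := B) (D := G) (E := E) (G := D) (a := a) (b := c) (c := b)
    (d := g) (e := e) (g := d) (W := fun y₀ y₁ => W y₁ y₀) (P := fun y₀ y₁ => P y₁ y₀) (ℓ := fun y₀ y₁ => ℓ y₁ y₀)
    (fun y₀ y₁ => by rw [hW]; ring) (fun y₀ y₁ => by rw [hP]; ring) (fun y₀ y₁ => by rw [hℓ]; ring)
    hG (by linear_combination hDG) hβ (fun y₀ y₁ => by rw [hpde, add_comm D G])

/-! ## All heights -/

/-- ★ **One transverse rank-one height ⇒ constant structure function.**  Data of part II at every height, `γ` differentiable; if at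
ONE height `z₀` the quadratic part is rank one with `D(z₀) ≠ 0`, `D G = E²` and `C D − B E ≠ 0` there, then `γ' ≡ 0` on `ℝ`. [folklore] -/
theorem quadSlice_rank1_TH {A B C D E G A'' B'' C'' D' G' D'' E'' G'' γ γ' : ℝ → ℝ}
    (hγ : ∀ t, HasDerivAt γ (γ' t) t)
    (hD : ∀ z, HasDerivAt D (D' z) z) (hD' : ∀ z, HasDerivAt D' (D'' z) z)
    (hG : ∀ z, HasDerivAt G (G' z) z) (hG' : ∀ z, HasDerivAt G' (G'' z) z)
    {z₀ : ℝ} (hD₀ : D z₀ ≠ 0) (hDG : D z₀ * G z₀ = E z₀ ^ 2) (hβ : C z₀ * D z₀ - B z₀ * E z₀ ≠ 0)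
    (hpde : ∀ z y₀ y₁ : ℝ,
      A'' z + B'' z * y₀ + C'' z * y₁ + (D'' z * y₀ ^ 2 + 2 * E'' z * y₀ * y₁ + G'' z * y₁ ^ 2) / 2 =
        γ (A z + B z * y₀ + C z * y₁ + (D z * y₀ ^ 2 + 2 * E z * y₀ * y₁ + G z * y₁ ^ 2) / 2) * (D z + G z) +
          γ' (A z + B z * y₀ + C z * y₁ + (D z * y₀ ^ 2 + 2 * E z * y₀ * y₁ + G z * y₁ ^ 2) / 2) *
            ((B z + D z * y₀ + E z * y₁) ^ 2 + (C z + E z * y₀ + G z * y₁) ^ 2)) :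
    ∀ t, γ' t = 0 := by
  obtain ⟨γ₀, μ, hγaff, hγ'⟩ := quadSlice_rank1_affine hγ
    (W := fun y₀ y₁ => A z₀ + B z₀ * y₀ + C z₀ * y₁ + (D z₀ * y₀ ^ 2 + 2 * E z₀ * y₀ * y₁ + G z₀ * y₁ ^ 2) / 2)
    (P := fun y₀ y₁ => (B z₀ + D z₀ * y₀ + E z₀ * y₁) ^ 2 + (C z₀ + E z₀ * y₀ + G z₀ * y₁) ^ 2)
    (ℓ := fun y₀ y₁ => A'' z₀ + B'' z₀ * y₀ + C'' z₀ * y₁ + (D'' z₀ * y₀ ^ 2 + 2 * E'' z₀ * y₀ * y₁ + G'' z₀ * y₁ ^ 2) / 2)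
    (fun _ _ => rfl) (fun _ _ => rfl) (fun _ _ => rfl) hD₀ hDG hβ (fun y₀ y₁ => hpde z₀ y₀ y₁)
  have hpde' : ∀ z y₀ y₁ : ℝ,
      A'' z + B'' z * y₀ + C'' z * y₁ + (D'' z * y₀ ^ 2 + 2 * E'' z * y₀ * y₁ + G'' z * y₁ ^ 2) / 2 =
        (γ₀ + 2 * μ * (A z + B z * y₀ + C z * y₁ + (D z * y₀ ^ 2 + 2 * E z * y₀ * y₁ + G z * y₁ ^ 2) / 2)) *
            (D z + G z) +
          2 * μ * ((B z + D z * y₀ + E z * y₁) ^ 2 + (C z + E z * y₀ + G z * y₁) ^ 2) := by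
    intro z y₀ y₁
    rw [hpde z y₀ y₁, hγaff, hγ']
  have hμ0 : μ = 0 := by
    by_contra hne
    exact hD₀ (quadSlice_flat_of_affine_thick hne hD hD' hG hG' hpde' z₀).1
  intro t
  rw [hγ' t, hμ0, mul_zero]

end Summit.NavierStokesRegularity.NavierStokesRegularity.Theorems.PoloidalWindowDoorPoloidalWindowRigidityZShockTurningShearParabolic

end
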